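import Summits.QuantumFields.GaugeBoot.Rows.KZL2HD3HTab
import HarnessLib

/-!
# Gauge-boot: kernel check of the raw `H` class table of the kz-L2-H-3D problems, rows 45–93 (part 2/7)

Cell `pub-gaugeboot` (HOME `run/shared/lean/pub/pub-gaugeboot/`), seat lean1 (torus layer for rows C1–C2 (and C41–C50) = the certified
kz-L2-H-3D windows: label set, raw blocks, class/witness tables, the reduction identity, per-β bindings).

HONEST FRAMING (page 1 of every file of this cell): certified bounds on lattice expectations at STATED coupling,
gauge group, dimension and torus size; NOT a mass gap, NOT a continuum limit, NOT a string tension, NOT large `N`.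
The venture is explicitly NOT Yang–Mills-summit-bearing (barriers `FixedCouplingUltralocality`,
`PerturbativeInvisibility`).

`hcanon_rows_<lo>_<hi> : ∀ i, lo ≤ i < hi → ∀ j ≥ i, KZL2HD3.HCanonOK i j`, each range one closed computation (`decide +kernel`);
assembled in `KZL2HD3Canon`.
-/

noncomputable section

open Literature.MathematicalPhysics.QuantumFieldTheory

namespace Summit.QuantumFields.GaugeBoot

namespace KZL2HD3

set_option maxHeartbeats 0 in
/-- Rows `45 ≤ i < 54` of the `H` class table of the kz-L2-H-3D problems canonicalise (4536 entries; kernel). -/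
theorem hcanon_rows_45_54 : ∀ i : Fin 553, 45 ≤ i.val → i.val < 54 → ∀ j : Fin 553, i.val ≤ j.val → KZL2HD3.HCanonOK i j := by
  decide +kernel

set_option maxHeartbeats 0 in
/-- Rows `54 ≤ i < 64` of the `H` class table of the kz-L2-H-3D problems canonicalise (4945 entries; kernel). -/
theorem hcanon_rows_54_64 : ∀ i : Fin 553, 54 ≤ i.val → i.val < 64 → ∀ j : Fin 553, i.val ≤ j.val → KZL2HD3.HCanonOK i j := by
  decide +kernel

set_option maxHeartbeats 0 in
/-- Rows `64 ≤ i < 74` of the `H` class table of the kz-L2-H-3D problems canonicalise (4845 entries; kernel). -/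
theorem hcanon_rows_64_74 : ∀ i : Fin 553, 64 ≤ i.val → i.val < 74 → ∀ j : Fin 553, i.val ≤ j.val → KZL2HD3.HCanonOK i j := by
  decide +kernel

set_option maxHeartbeats 0 in
/-- Rows `74 ≤ i < 84` of the `H` class table of the kz-L2-H-3D problems canonicalise (4745 entries; kernel). -/
theorem hcanon_rows_74_84 : ∀ i : Fin 553, 74 ≤ i.val → i.val < 84 → ∀ j : Fin 553, i.val ≤ j.val → KZL2HD3.HCanonOK i j := by
  decide +kernel

set_option maxHeartbeats 0 in
/-- Rows `84 ≤ i < 94` of the `H` class table of the kz-L2-H-3D problems canonicalise (4645 entries; kernel). -/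
theorem hcanon_rows_84_94 : ∀ i : Fin 553, 84 ≤ i.val → i.val < 94 → ∀ j : Fin 553, i.val ≤ j.val → KZL2HD3.HCanonOK i j := by
  decide +kernel

end KZL2HD3

end Summit.QuantumFields.GaugeBoot

end
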